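import Summits.Ventures.HodgeRepro2.T5Sl2Standard

/-!
# The rotation group `k(θ)` is a one-parameter group with infinitesimal generator `W`

Tier-5 support (N4.3 = (R3), step (P2′): `K_W ∩ H_j¹ = SO(2)` in the angle coordinate `k(θ)`;
route/T5-SUPPORT-p1.md §S4.13, §S4.16).  For the rotation matrices `rotation θ = k(θ)` and the
generator `W = !![0, 1; -1, 0]` of `T5Sl2Standard`:

* `rotationC_zero`, `rotationC_mul`, `rotation_inv`: `θ ↦ k(θ)` is a group homomorphism
  `ℝ → SL₂`, `k(θ) k(φ) = k(θ + φ)`, `k(θ)⁻¹ = k(−θ)`, with `det k(θ) = 1` (`det_rotationC`);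
* `hasDerivAt_rotationC`: `k'(θ₀) = k(θ₀) W = W k(θ₀)` entrywise, in particular `k'(0) = W`
  (`hasDerivAt_rotationC_zero`) — `W` is the infinitesimal generator of `SO(2)`, and by
  `T5Sl2Standard.cayley_h₀` the Cayley transform carries `−I • W` to `h₀ = diag(1, −1)`: the
  `h₀`-eigenvalue of the `𝔰𝔩₂` lane is the infinitesimal `SO(2)`-weight.

What this file does NOT say: the exponential `k(θ) = exp (θ W)` as a matrix exponential, and the
group-level statement that an `h₀`-eigenvector of eigenvalue `n` transforms by `e^{inθ}` — the
printed inputs of (P2′) ([C]/[A]).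

Blind lane: Mathlib + own prefix; no sorry; axioms ⊆ {propext, Classical.choice, Quot.sound}.
-/

namespace Summit.Ventures.HodgeRepro2.T5RotationGenerator

open Matrix
open Summit.Ventures.HodgeRepro2.T5Sl2Standard (rotation W)

/-- `k(0) = 1`. -/
lemma rotationC_zero : rotation 0 = 1 := by
  ext i j
  fin_cases i <;> fin_cases j <;> simp [T5Sl2Standard.rotation]

/-- `k(θ) k(φ) = k(θ + φ)`. -/
lemma rotationC_mul (θ φ : ℝ) : rotation θ * rotation φ = rotation (θ + φ) := by
  ext i j
  fin_cases i <;> fin_cases j <;>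
    simp [T5Sl2Standard.rotation, Matrix.mul_apply, Fin.sum_univ_two, Complex.cos_add,
      Complex.sin_add] <;> ring

/-- `k(θ) k(−θ) = 1`. -/
lemma rotationC_mul_neg (θ : ℝ) : rotation θ * rotation (-θ) = 1 := by
  rw [rotationC_mul, add_neg_cancel, rotationC_zero]

/-- `det k(θ) = 1`. -/
lemma det_rotationC (θ : ℝ) : (rotation θ).det = 1 := by
  rw [T5Sl2Standard.rotation, Matrix.det_fin_two_of]
  have h : ((Real.cos θ : ℂ) * Real.cos θ - Real.sin θ * -(Real.sin θ : ℂ)) =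
      ((Real.cos θ ^ 2 + Real.sin θ ^ 2 : ℝ) : ℂ) := by push_cast; ring
  rw [h, Real.cos_sq_add_sin_sq, Complex.ofReal_one]

/-- `k(θ) W = W k(θ)`. -/
lemma rotationC_mul_W (θ : ℝ) : rotation θ * W = W * rotation θ := by
  ext i j
  fin_cases i <;> fin_cases j <;>
    simp [T5Sl2Standard.rotation, T5Sl2Standard.W, Matrix.mul_apply, Fin.sum_univ_two]

/-- **The infinitesimal generator**: `k'(θ₀) = k(θ₀) W` entrywise. -/
theorem hasDerivAt_rotationC (θ₀ : ℝ) (i j : Fin 2) :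
    HasDerivAt (fun θ : ℝ => rotation θ i j) ((rotation θ₀ * W) i j) θ₀ := by
  have hc : HasDerivAt (fun θ : ℝ => (Real.cos θ : ℂ)) (-(Real.sin θ₀ : ℂ)) θ₀ := by
    have := (Real.hasDerivAt_cos θ₀).ofReal_comp
    simpa using this
  have hs : HasDerivAt (fun θ : ℝ => (Real.sin θ : ℂ)) ((Real.cos θ₀ : ℂ)) θ₀ :=
    (Real.hasDerivAt_sin θ₀).ofReal_comp
  fin_cases i <;> fin_cases j
  · simpa [T5Sl2Standard.rotation, T5Sl2Standard.W, Matrix.mul_apply, Fin.sum_univ_two] using hc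
  · simpa [T5Sl2Standard.rotation, T5Sl2Standard.W, Matrix.mul_apply, Fin.sum_univ_two] using hs
  · have := hs.neg
    simpa [T5Sl2Standard.rotation, T5Sl2Standard.W, Matrix.mul_apply, Fin.sum_univ_two,
      Pi.neg_def] using this
  · simpa [T5Sl2Standard.rotation, T5Sl2Standard.W, Matrix.mul_apply, Fin.sum_univ_two] using hc

/-- `k'(0) = W`: `W` is the infinitesimal generator of the rotation group. -/
theorem hasDerivAt_rotationC_zero (i j : Fin 2) :
    HasDerivAt (fun θ : ℝ => rotation θ i j) (W i j) 0 := by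
  have := hasDerivAt_rotationC 0 i j
  rwa [rotationC_zero, one_mul] at this

end Summit.Ventures.HodgeRepro2.T5RotationGenerator
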